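import Summits.QuantumFields.YangMills.Theorems.BalabanUVNodesN08HaarCompatibilityGuardMonotoneInjectiveSUN
import Summits.QuantumFields.YangMills.Theorems.BalabanUVNodesN08HaarCompatibilityGuardMonotoneInjective

/-!
# BalabanUVNodes ∕ N08 — THE PRINTED exp-mean-log FIBRE MAP IS INJECTIVE ON ITS WHOLE GUARD SET `‖hᵢW* − 1‖ < 1∕3` FOR EVERY `N` AND EVERY
# `Σcᵢ ≤ 1 − 1∕300` (piece (v-a): the constants of part (iv) at the typed guard, certified)

WIDTH SEAT `pub-ymgap-dag-n08-w6` g6 (R399 (3a); CLAIM-1 of record HOME INBOX l.38866), 2026-08-28.  Track A, DAG node N08 = [Balaban1985UV3] Thm 1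
p. 257 (compact) + Thm 2 p. 272; [Balaban1987RG1] (0.4) p. 253; key item K1⁷ `StabilityBAtRecordR13SepCoPH` (stmt-QuantumFields-20542), `--supports … --as
helper`.  COUNT-NEUTRAL.

THE MATHEMATICS ([folklore]).  Part (iv) (`…GuardMonotoneInjectiveSUN.kmat_injOn`) proves injectivity of `K(W) = exp(Σcᵢlog(hᵢW*))·W` on the guard set
`{W unitary : ∀ i ‖hᵢW* − 1‖ < δ}` (`δ ≤ 1∕3`) for EVERY `N`, given a radius `ρ` for `‖log(hᵢW*)‖`, symbol constants `(a₀, K)` and the closing inequality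
`κν(πδ)∕4 < c₁`.  Here they are supplied at the typed guard:
 §1 THE SHARP CHORD–ANGLE BOUND (every `N`): a unitary `P` with `‖P − 1‖ < δ ≤ 2 sin(θ∕2)`, `θ ≤ 1∕2`, has `‖log P‖ < θ` — `P = e^{iA}`, `A` Hermitian
    (pub-balaban `MatrixLog.exists_isHermitian_exp_eq`), `‖P − 1‖² = 2(1 − cos‖A‖)` (Mathlib `selfAdjoint.norm_sq_expUnitary_sub_one`), `cos` strictly decreasing,
    `log e^{iA} = iA` (`B7BlockAvgLog.mlog_exp`); at `δ ≤ 1∕3`: `ρ = 17∕50` (`1∕3 ≤ 2 sin(17∕100)`).  (n08-w3's 26A `norm_qlog_lt_of_chord` is the `S³` case.)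
 §2 THE SYMBOL: for `|β| ≤ 17∕50`, `Re(e^{−iβ}sinc β) = cos β·sinc β ≥ a₀ := (1 − θ²∕6)(1 − θ²∕2)` (`θ = 17∕50`; 30B's `sinc_mul_cos_bounds`) and
    `|e^{−iβ}sinc β − a₀|² ≤ K := (1 − a₀)² + θ²` (`|sin β| ≤ |β|`, `0 ≤ sinc ≤ 1`).
 §3 THE CLOSING INEQUALITY on `1∕300 ≤ λ = 1 − Σcᵢ ≤ 1`: `ψ(17∕50) ≤ 1∕24` (30C's `ψ_slot_le`), `ψ` monotone, `e^{17s∕50} ≤ 1∕(1 − 17∕50)`, `π < 3.1416`,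
    then a concave-versus-linear polynomial inequality in `λ` checked at the two ends.
 §4 ★★★ `kmat_injOn_third`: **for EVERY `N`, unitaries `hᵢ`, weights `cᵢ ≥ 0` with `Σcᵢ ≤ 1 − 1∕300`, and `δ ≤ 1∕3`, the map `W ↦ exp(Σcᵢlog(hᵢW*))·W` is
    INJECTIVE on `{W unitary : ∀ i ‖hᵢW* − 1‖ < δ}`** (30C `injOn_kf_slot400`: `N = 2`, `Σcᵢ ≤ 1 − 1∕400`, by quaternions).  At the [B10] slot `1 − Σcᵢ = L^{1−d}`,
    so this covers `L^{d−1} ≤ 300` — every `L ≤ 17` at `d = 3`.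

HONEST FRAMING.  Count-neutral helper ([folklore] BY IMPORT); STILL A RANGE (`Σcᵢ ≤ 1 − 1∕300`; every `L` with an existential sheet count is g5's
`…GuardCoreLawSUN`); NO (H_K) ∕ density statement in THIS file (piece (v-b): one window in g5's `…CoreChartConjugateSUN` ⇒ explicit `K`); nothing of Bałaban's
asserted; ONE RG step — the k-uniform `hmass` is NOT supplied; E6′ NOT decided; N08 NOT discharged; counts unmoved (typed 28∕28 · discharged 5∕27); no summit statement
is proved by this seat — R4 closes the CONDITIONAL rung `BalabanLadder.UV` only; the Yang–Mills mass gap (Clay) is NOT proved by any of this; nothing continuum ∕ ℝ⁴ ∕ OS.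
0 `sorry`, 0 `def`, 0 `instance`, 0 `notation`, standard axioms.
-/

noncomputable section

open NormedSpace Finset Set
open scoped Matrix Matrix.Norms.L2Operator ComplexConjugate Nat

namespace Summit.QuantumFields.YangMills.BalabanUVNodes.N08HaarCompatibilityGuardMonotoneInjectiveSUNSlot

open Literature.MathematicalPhysics.QuantumFieldTheory.Balaban1983to89
open Literature.MathematicalPhysics.QuantumFieldTheory.Balaban1983to89.T4EMLTangentInjective
open Summit.QuantumFields.YangMills.BalabanUVNodes.N08HaarCompatibilityGuardJacobianContractionFrame
open Summit.QuantumFields.YangMills.BalabanUVNodes.N08HaarCompatibilityGuardMonotoneInjectiveSUN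
open Summit.QuantumFields.YangMills.BalabanUVNodes.N08HaarCompatibilityGuardMonotonePairing (sinc_mul_cos_bounds)
open Summit.QuantumFields.YangMills.BalabanUVNodes.N08HaarCompatibilityGuardMonotoneInjective (ψ_slot_le)
open Matrix (unitaryGroup)
open Complex (I)
open Literature.MathematicalPhysics.QuantumFieldTheory.Balaban1983to89.MatrixLog (mlog)
open T4QuatExpLog (ψ ψ_zero ψ_of_ne_zero)

variable {m : Type*} [Fintype m] [DecidableEq m] [Nonempty m] {ι : Type*} [Fintype ι]

/-! ## §1 The sharp chord–angle bound for the matrix logarithm of a unitary -/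

omit [Nonempty m] [Fintype ι] in
/-- ★★ **THE SHARP CHORD–ANGLE BOUND, EVERY `N`.**  A unitary `P` with `‖P − 1‖ < δ ≤ 2 sin(θ∕2)`, `0 < θ ≤ 1∕2`, has `‖log P‖ < θ`
(`P = e^{iA}`, `‖P − 1‖² = 2(1 − cos‖A‖)`, `log e^{iA} = iA`). [folklore] -/
theorem norm_mlog_lt_of_unitary {P : Matrix m m ℂ} (hP : P ∈ unitaryGroup m ℂ) {δ θ : ℝ} (hPδ : ‖P - 1‖ < δ)
    (hθ0 : 0 < θ) (hθ : θ ≤ 1 / 2) (hδθ : δ ≤ 2 * Real.sin (θ / 2)) : ‖mlog P‖ < θ := by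
  letI : CStarAlgebra (Matrix m m ℂ) := {}
  obtain ⟨A, hA, hAπ, hexp, -, -⟩ := MatrixLog.exists_isHermitian_exp_eq hP
  have hsq : ‖P - 1‖ ^ 2 = 2 * (1 - Real.cos ‖A‖) := by
    have h := selfAdjoint.norm_sq_expUnitary_sub_one (A := Matrix m m ℂ) (x := ⟨A, hA.isSelfAdjoint⟩) (by simpa using hAπ)
    simpa [selfAdjoint.expUnitary_coe, hexp] using h
  have hθπ : θ ≤ Real.pi := by linarith [Real.pi_gt_three]
  -- `2(1 − cos‖A‖) < 4 sin²(θ/2) = 2(1 − cos θ)`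
  have h0 : 0 ≤ ‖P - 1‖ := norm_nonneg _
  have h1 : ‖P - 1‖ ^ 2 < (2 * Real.sin (θ / 2)) ^ 2 := by
    have : ‖P - 1‖ < 2 * Real.sin (θ / 2) := hPδ.trans_le hδθ
    exact pow_lt_pow_left₀ this h0 two_ne_zero
  have h2 : (2 * Real.sin (θ / 2)) ^ 2 = 2 * (1 - Real.cos θ) := by
    rw [mul_pow, Real.sin_sq, Real.cos_sq, show 2 * (θ / 2) = θ by ring]; ring
  have hcos : Real.cos θ < Real.cos ‖A‖ := by rw [hsq, h2] at h1; linarith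
  have hAθ : ‖A‖ < θ := by
    by_contra hle
    push Not at hle
    have := Real.cos_le_cos_of_nonneg_of_le_pi hθ0.le hAπ hle
    linarith
  have hIA : ‖(I • A : Matrix m m ℂ)‖ = ‖A‖ := by rw [norm_smul, Complex.norm_I, one_mul]
  rw [← hexp, B7BlockAvgLog.mlog_exp (by rw [hIA]; linarith [Real.log_two_gt_d9]), hIA]
  exact hAθ

omit [Nonempty m] [Fintype ι] in
/-- **At the typed guard `δ ≤ 1∕3`: `‖log(hW*)‖ ≤ 17∕50`** for unitaries `h, W` with `‖hW* − 1‖ < δ` (`1∕3 ≤ 2 sin(17∕100)`). [folklore] -/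
theorem norm_mlog_le_of_guard_third {h W : Matrix m m ℂ} (hh : h ∈ unitaryGroup m ℂ) (hW : W ∈ unitaryGroup m ℂ) {δ : ℝ}
    (hδ : δ ≤ 1 / 3) (hg : ‖h * star W - 1‖ < δ) : ‖mlog (h * star W)‖ ≤ 17 / 50 := by
  have hsin : (1 : ℝ) / 3 ≤ 2 * Real.sin (17 / 50 / 2) := by
    have := Real.sin_gt_sub_cube (show (0 : ℝ) < 17 / 50 / 2 by norm_num)
    nlinarith
  exact (norm_mlog_lt_of_unitary (mul_mem hh (Unitary.star_mem hW)) hg (by norm_num) (by norm_num) (hδ.trans hsin)).le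

/-! ## §2 The symbol constants on `|β| ≤ 17∕50` -/

omit [Fintype m] [DecidableEq m] [Nonempty m] [Fintype ι] in
/-- The real part: `Re(e^{−iβ}·sinc β) = cos β·sinc β`; the norm of the defect: `|e^{−iβ}sinc β − a|² = (cos β sinc β − a)² + (sin β sinc β)²`. [folklore] -/
theorem symbol_re_and_sq (β a : ℝ) :
    (Complex.exp (-I * (β : ℂ)) * ((Real.sinc β : ℝ) : ℂ)).re = Real.cos β * Real.sinc β ∧
      ‖Complex.exp (-I * (β : ℂ)) * ((Real.sinc β : ℝ) : ℂ) - a‖ ^ 2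
        = (Real.cos β * Real.sinc β - a) ^ 2 + (Real.sin β * Real.sinc β) ^ 2 := by
  have he : Complex.exp (-I * (β : ℂ)) = (Real.cos β : ℂ) - I * (Real.sin β : ℂ) := by
    rw [show -I * (β : ℂ) = (-(β : ℂ)) * I by ring, Complex.exp_mul_I, Complex.cos_neg, Complex.sin_neg,
      Complex.ofReal_cos, Complex.ofReal_sin]
    ring
  constructor
  · rw [he]
    simp only [Complex.mul_re, Complex.sub_re, Complex.sub_im, Complex.ofReal_re, Complex.ofReal_im, Complex.I_re,
      Complex.I_im, Complex.mul_im]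
    ring
  · rw [he, Complex.sq_norm, Complex.normSq_apply]
    simp only [Complex.mul_re, Complex.mul_im, Complex.sub_re, Complex.sub_im, Complex.ofReal_re, Complex.ofReal_im,
      Complex.I_re, Complex.I_im]
    ring

omit [Fintype m] [DecidableEq m] [Nonempty m] [Fintype ι] in
/-- **The symbol bounds at `θ = 17∕50`**: for `|β| ≤ 17∕50`, with `a₀ = (1 − θ²∕6)(1 − θ²∕2)`, `K = (1 − a₀)² + θ²`:
`a₀ ≤ Re(e^{−iβ}sinc β)` and `|e^{−iβ}sinc β − a₀|² ≤ K`. [folklore] -/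
theorem symbol_bounds_third {β : ℝ} (hβ : |β| ≤ 17 / 50) :
    (1 - (17 / 50 : ℝ) ^ 2 / 6) * (1 - (17 / 50 : ℝ) ^ 2 / 2) ≤ (Complex.exp (-I * (β : ℂ)) * ((Real.sinc β : ℝ) : ℂ)).re ∧
      ‖Complex.exp (-I * (β : ℂ)) * ((Real.sinc β : ℝ) : ℂ) - ((1 - (17 / 50 : ℝ) ^ 2 / 6) * (1 - (17 / 50 : ℝ) ^ 2 / 2) : ℝ)‖ ^ 2
        ≤ (1 - (1 - (17 / 50 : ℝ) ^ 2 / 6) * (1 - (17 / 50 : ℝ) ^ 2 / 2)) ^ 2 + (17 / 50 : ℝ) ^ 2 := by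
  obtain ⟨hre, hsq⟩ := symbol_re_and_sq β ((1 - (17 / 50 : ℝ) ^ 2 / 6) * (1 - (17 / 50 : ℝ) ^ 2 / 2))
  -- reduce to `t = |β| ≥ 0` (cos, sinc even; sin odd)
  have hb := sinc_mul_cos_bounds (abs_nonneg β) hβ (by norm_num)
  have hcs : Real.sinc |β| * Real.cos |β| = Real.cos β * Real.sinc β := by
    rcases le_or_gt 0 β with h | h
    · rw [abs_of_nonneg h, mul_comm]
    · rw [abs_of_neg h, Real.sinc_neg, Real.cos_neg, mul_comm]
  have hsinc : Real.sinc |β| = Real.sinc β := by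
    rcases le_or_gt 0 β with h | h
    · rw [abs_of_nonneg h]
    · rw [abs_of_neg h, Real.sinc_neg]
  rw [hcs] at hb
  rw [hsinc] at hb
  obtain ⟨hlo, hhi, hs0, hs1⟩ := hb
  refine ⟨by rw [hre]; exact hlo, ?_⟩
  rw [hsq]
  have h1 : (Real.cos β * Real.sinc β - (1 - (17 / 50 : ℝ) ^ 2 / 6) * (1 - (17 / 50 : ℝ) ^ 2 / 2)) ^ 2
      ≤ (1 - (1 - (17 / 50 : ℝ) ^ 2 / 6) * (1 - (17 / 50 : ℝ) ^ 2 / 2)) ^ 2 := by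
    have : 0 ≤ Real.cos β * Real.sinc β - (1 - (17 / 50 : ℝ) ^ 2 / 6) * (1 - (17 / 50 : ℝ) ^ 2 / 2) := by linarith
    nlinarith
  have h2 : (Real.sin β * Real.sinc β) ^ 2 ≤ (17 / 50 : ℝ) ^ 2 := by
    have hs : (Real.sin β) ^ 2 ≤ β ^ 2 := Real.sin_sq_le_sq
    have hb2 : β ^ 2 ≤ (17 / 50 : ℝ) ^ 2 := by
      have := abs_le.mp hβ; nlinarith
    calc (Real.sin β * Real.sinc β) ^ 2 = Real.sin β ^ 2 * Real.sinc β ^ 2 := by ring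
      _ ≤ β ^ 2 * 1 := by
          apply mul_le_mul hs _ (sq_nonneg _) (sq_nonneg β)
          nlinarith
      _ ≤ (17 / 50 : ℝ) ^ 2 := by linarith
  linarith

/-! ## §3 The closing inequality at `ρ = 17∕50`, `δ ≤ 1∕3`, `Σcᵢ ≤ 1 − 1∕300` -/

omit [Fintype m] [DecidableEq m] [Nonempty m] [Fintype ι] in
/-- **The closing inequality**: for `0 ≤ s ≤ 1 − 1∕300` and `δ ≤ 1∕3`, with `a₀ = (1 − θ²∕6)(1 − θ²∕2)`, `K = (1 − a₀)² + θ²`, `θ = 17∕50`: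
`(1 − s + sψθ)·(e^{sθ}(1 − s + ψ(sθ) + sψθ))·(πδ)∕4 < a₀(1 − s) − sψθ·K∕(4a₀)` (`ψθ ≤ 1∕24`, `ψ(sθ) ≤ ψθ`, `e^{sθ} ≤ 1∕(1 − θ)`, `π < 3.1416`,
then a concave-vs-linear polynomial inequality in `1 − s`). [folklore] -/
theorem closing_third {s δ : ℝ} (hs0 : 0 ≤ s) (hs : s ≤ 1 - 1 / 300) (hδ0 : 0 ≤ δ) (hδ : δ ≤ 1 / 3) :
    (1 - s + s * ψ (17 / 50)) * (Real.exp (s * (17 / 50)) * (1 - s + ψ (s * (17 / 50)) + s * ψ (17 / 50))) * (Real.pi * δ) / 4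
      < (1 - (17 / 50 : ℝ) ^ 2 / 6) * (1 - (17 / 50 : ℝ) ^ 2 / 2) * (1 - s)
        - s * ψ (17 / 50) * ((1 - (1 - (17 / 50 : ℝ) ^ 2 / 6) * (1 - (17 / 50 : ℝ) ^ 2 / 2)) ^ 2 + (17 / 50 : ℝ) ^ 2)
          / (4 * ((1 - (17 / 50 : ℝ) ^ 2 / 6) * (1 - (17 / 50 : ℝ) ^ 2 / 2))) := by
  have hψ : ψ (17 / 50) ≤ 1 / 24 := ψ_slot_le
  have hψ0 : 0 ≤ ψ (17 / 50) := ψ_nonneg_of_abs_lt_pi (by rw [abs_of_pos (by norm_num)]; linarith [Real.pi_gt_three])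
  have hψs : ψ (s * (17 / 50)) ≤ ψ (17 / 50) :=
    ψ_le_ψ_of_abs_le (by rw [abs_of_nonneg (by positivity)]; nlinarith) (by linarith [Real.pi_gt_three])
  have hψs0 : 0 ≤ ψ (s * (17 / 50)) :=
    ψ_nonneg_of_abs_lt_pi (by rw [abs_of_nonneg (by positivity)]; nlinarith [Real.pi_gt_three])
  have hexp : Real.exp (s * (17 / 50)) ≤ 50 / 33 := by
    have h1 : Real.exp (s * (17 / 50)) ≤ Real.exp (17 / 50) := Real.exp_le_exp.mpr (by nlinarith)
    have h2 : Real.exp (17 / 50) ≤ 1 / (1 - 17 / 50) := Real.exp_bound_div_one_sub_of_interval (by norm_num) (by norm_num)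
    have h3 : (1 : ℝ) / (1 - 17 / 50) = 50 / 33 := by norm_num
    linarith
  have hexp0 : 0 ≤ Real.exp (s * (17 / 50)) := (Real.exp_pos _).le
  have hπ := Real.pi_lt_d4
  have hπ0 := Real.pi_pos
  -- abbreviations for the two sides
  set l : ℝ := 1 - s with hl
  have hl0 : 1 / 300 ≤ l := by rw [hl]; linarith
  have hl1 : l ≤ 1 := by rw [hl]; linarith
  -- bound the left side by a polynomial in `l`
  have hA : 1 - s + s * ψ (17 / 50) ≤ l + 1 / 24 := by rw [hl]; nlinarith
  have hA0 : 0 ≤ 1 - s + s * ψ (17 / 50) := by nlinarith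
  have hB : 1 - s + ψ (s * (17 / 50)) + s * ψ (17 / 50) ≤ l + 1 / 12 := by rw [hl]; nlinarith
  have hB0 : 0 ≤ 1 - s + ψ (s * (17 / 50)) + s * ψ (17 / 50) := by nlinarith
  have hLHS : (1 - s + s * ψ (17 / 50)) * (Real.exp (s * (17 / 50)) * (1 - s + ψ (s * (17 / 50)) + s * ψ (17 / 50)))
      * (Real.pi * δ) / 4 ≤ (l + 1 / 24) * ((50 / 33) * (l + 1 / 12)) * (3.1416 * (1 / 3)) / 4 := by
    have h1 : Real.exp (s * (17 / 50)) * (1 - s + ψ (s * (17 / 50)) + s * ψ (17 / 50)) ≤ (50 / 33) * (l + 1 / 12) :=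
      mul_le_mul hexp hB hB0 (by norm_num)
    have h2 : Real.pi * δ ≤ 3.1416 * (1 / 3) := mul_le_mul hπ.le hδ hδ0 (by norm_num)
    have h3 : 0 ≤ Real.exp (s * (17 / 50)) * (1 - s + ψ (s * (17 / 50)) + s * ψ (17 / 50)) := mul_nonneg hexp0 hB0
    have h4 : 0 ≤ Real.pi * δ := mul_nonneg hπ0.le hδ0
    have := mul_le_mul (mul_le_mul hA h1 h3 (by positivity)) h2 h4 (by positivity)
    linarith
  -- bound the right side from below by a linear function of `l`
  set a₀ : ℝ := (1 - (17 / 50 : ℝ) ^ 2 / 6) * (1 - (17 / 50 : ℝ) ^ 2 / 2) with ha₀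
  set K : ℝ := (1 - a₀) ^ 2 + (17 / 50 : ℝ) ^ 2 with hK
  have ha₀v : a₀ = 69303521 / 75000000 := by rw [ha₀]; norm_num
  have hRHS : a₀ * l - K / (96 * a₀) ≤ a₀ * (1 - s) - s * ψ (17 / 50) * K / (4 * a₀) := by
    rw [← hl]
    have hK0 : 0 ≤ K := by rw [hK]; positivity
    have ha₀0 : 0 < a₀ := by rw [ha₀v]; norm_num
    have h1 : s * ψ (17 / 50) ≤ 1 / 24 := by nlinarith
    have h2 : s * ψ (17 / 50) * K / (4 * a₀) ≤ (1 / 24) * K / (4 * a₀) := by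
      apply div_le_div_of_nonneg_right _ (by positivity)
      exact mul_le_mul_of_nonneg_right h1 hK0
    have h3 : (1 / 24 : ℝ) * K / (4 * a₀) = K / (96 * a₀) := by field_simp; ring
    linarith
  -- the polynomial inequality on `[1/300, 1]` (concave left side vs linear right side: check the ends)
  have hpoly : (l + 1 / 24) * ((50 / 33) * (l + 1 / 12)) * (3.1416 * (1 / 3)) / 4 < a₀ * l - K / (96 * a₀) := by
    rw [hK, ha₀v]
    nlinarith [mul_nonneg (sub_nonneg.2 hl0) (sub_nonneg.2 hl1)]
  linarith

/-! ## §4 GLOBAL INJECTIVITY AT THE TYPED GUARD, EVERY `N` -/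

/-- ★★★ **THE PRINTED exp-mean-log FIBRE MAP IS INJECTIVE ON ITS WHOLE GUARD SET, FOR EVERY `N`.**  For unitaries `hᵢ ∈ U(N)`, weights `cᵢ ≥ 0` with
`Σcᵢ ≤ 1 − 1∕300`, and a guard radius `δ ≤ 1∕3`:
  `Set.InjOn (W ↦ exp(Σᵢ cᵢ log(hᵢW*))·W) {W ∈ U(N) : ∀ i, ‖hᵢW* − 1‖ < δ}`.
(Part (iv)'s `kmat_injOn` with `ρ = 17∕50` (§1), the symbol constants of §2 and the certified closing inequality of §3; N-independent.) [folklore] -/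
theorem kmat_injOn_third {h : ι → Matrix m m ℂ} (hh : ∀ i, h i ∈ unitaryGroup m ℂ) {c : ι → ℝ} (hc0 : ∀ i, 0 ≤ c i)
    (hc1 : ∑ i, c i ≤ 1 - 1 / 300) {δ : ℝ} (hδ : δ ≤ 1 / 3) :
    Set.InjOn (Kmat h c) {W | W ∈ unitaryGroup m ℂ ∧ ∀ i, ‖h i * star W - 1‖ < δ} := by
  rcases isEmpty_or_nonempty ι with hι | ⟨⟨i₀⟩⟩
  · intro u hu u' hu' heq
    have hK0 : ∀ W : Matrix m m ℂ, Kmat h c W = W := fun W => by simp [Kmat]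
    simpa [hK0] using heq
  rcases lt_or_ge δ 0 with hδneg | hδ0
  · intro u hu u' hu' heq
    exact absurd ((norm_nonneg _).trans_lt (hu.2 i₀)) (not_lt.2 hδneg.le)
  have hs0 : 0 ≤ ∑ i, c i := Finset.sum_nonneg fun i _ => hc0 i
  have hs1 : ∑ i, c i ≤ 1 := hc1.trans (by norm_num)
  have hϑ : (∑ i, c i) * (17 / 50) ≤ 17 / 50 := by nlinarith
  exact kmat_injOn hh hc0 hs1 hδ (ρ := 17 / 50) (by norm_num) (by norm_num)
    (fun W hW hg i => norm_mlog_le_of_guard_third (hh i) hW hδ (hg i))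
    (a₀ := (1 - (17 / 50 : ℝ) ^ 2 / 6) * (1 - (17 / 50 : ℝ) ^ 2 / 2))
    (K := (1 - (1 - (17 / 50 : ℝ) ^ 2 / 6) * (1 - (17 / 50 : ℝ) ^ 2 / 2)) ^ 2 + (17 / 50 : ℝ) ^ 2) (by norm_num)
    (fun β hβ => (symbol_bounds_third (hβ.trans hϑ)).1) (fun β hβ => (symbol_bounds_third (hβ.trans hϑ)).2)
    (closing_third hs0 hc1 hδ0 hδ)

/-! ## §5 In `SU(N)` letters: any map agreeing with the printed fibre map on a `deltaSU`-guarded set is injective there -/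

/-- ★★★ **`SU(N)` LETTERS, EVERY `N`** (the every-`N` edition of 30C's `injOn_expMeanLog_deltaSU_of_le`): for `hᵢ ∈ SU(N)`, weights `cᵢ ≥ 0` with
`Σcᵢ ≤ 1 − 1∕300`, and a set `S ⊆ SU(N)` on which `‖hᵢW* − 1‖ < deltaSU = min(1∕3, π∕N)` for all `i`, every map `K : SU(N) → SU(N)` that agrees on `S` with
`W ↦ exp(Σcᵢlog(hᵢW*))·W` is injective on `S`. [folklore] -/
theorem injOn_of_eq_kmat_deltaSU {N : ℕ} [NeZero N] {S : Set (Matrix.specialUnitaryGroup (Fin N) ℂ)}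
    (h : ι → Matrix.specialUnitaryGroup (Fin N) ℂ) {c : ι → ℝ} (hc : ∀ i, 0 ≤ c i) (hs : ∑ i, c i ≤ 1 - 1 / 300)
    {K : Matrix.specialUnitaryGroup (Fin N) ℂ → Matrix.specialUnitaryGroup (Fin N) ℂ}
    (hg : ∀ W ∈ S, ∀ i, ‖(h i : Matrix (Fin N) (Fin N) ℂ) * star (W : Matrix (Fin N) (Fin N) ℂ) - 1‖ < ExpMeanLog.deltaSU (Fin N))
    (hKW : ∀ W ∈ S, (K W : Matrix (Fin N) (Fin N) ℂ)
      = Kmat (fun i => (h i : Matrix (Fin N) (Fin N) ℂ)) c (W : Matrix (Fin N) (Fin N) ℂ)) :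
    Set.InjOn K S := by
  have hhu : ∀ i, (h i : Matrix (Fin N) (Fin N) ℂ) ∈ unitaryGroup (Fin N) ℂ := fun i => (Matrix.mem_specialUnitaryGroup_iff.mp (h i).2).1
  have hinj := kmat_injOn_third (m := Fin N) hhu hc hs (δ := 1 / 3) le_rfl
  intro W hW W' hW' hKK
  have hWu : (W : Matrix (Fin N) (Fin N) ℂ) ∈ unitaryGroup (Fin N) ℂ := (Matrix.mem_specialUnitaryGroup_iff.mp W.2).1
  have hW'u : (W' : Matrix (Fin N) (Fin N) ℂ) ∈ unitaryGroup (Fin N) ℂ := (Matrix.mem_specialUnitaryGroup_iff.mp W'.2).1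
  have heq := hinj ⟨hWu, fun i => ExpMeanLog.lt_third_of_lt_deltaSU (hg W hW i)⟩
    ⟨hW'u, fun i => ExpMeanLog.lt_third_of_lt_deltaSU (hg W' hW' i)⟩ (by rw [← hKW W hW, ← hKW W' hW', hKK])
  exact Subtype.ext heq

end Summit.QuantumFields.YangMills.BalabanUVNodes.N08HaarCompatibilityGuardMonotoneInjectiveSUNSlot
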